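import Mathlib
import Summits.Ventures.HodgeRepro.Tier4.Common.AdelicDefs
import Summits.Ventures.HodgeRepro.Tier4.Common.AdelicRTF
import Summits.Ventures.HodgeRepro.Tier4.Line1.PlaneDefs
import Summits.Ventures.HodgeRepro.Tier4.Line1.TorusPair
import Summits.Ventures.HodgeRepro.Tier4.Line1.NormOneTorus
import Summits.Ventures.HodgeRepro.Tier4.Line1.LinRegular
import Summits.Ventures.HodgeRepro.Tier4.Line1.RTFDataOfCharacters

/-!
# Tier4/Line1/CornerCharacters — LINE L1, (I0-R): the toric characters `χ = ν₀ ⊗ ν₁`, `χ′ = ν₂ ⊗ ν₃` of the RTF datum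
from four `U(1)`-characters, and N2 as the displayed equation `ν₀ ν₁ = ν₂ ν₃` on `E′¹(𝔸)`

Blind re-derivation cell `pub-hodge-repro`, Tier 4 «prove the step» (README §9–§10), seat t4-L1-p2 (gen 3), LINE L1
(the relative-trace-formula line), cut (I0-R) «the character objects» (t4-plan-1 g2, S13462 (6)).  Target tree path
`lean/Summits/Ventures/HodgeRepro/Tier4/Line1/CornerCharacters.lean`.  Imports: typer-2's `AdelicDefs` / `AdelicRTF`
(the plane `PlaneData k`, `U(W)(𝔸_k)`, the tori `torusT W = commutant (P 0) ⊓ commutant (P 1)`, `torusT'`, the centre,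
`RTFData`), the line's `PlaneDefs` (`IsDefinite`, `IsGenuineRow`, `IsLinRegular`), part 1 of this cut
`Tier4/Line1/TorusPair.lean` (`pairOf D g` = the pair of scalars `(x, y, x′, y′)` of a torus element, read off the
conjugated matrix `S⁻¹ gᵀ S` in p5's adapted basis — no choice; `pairOf_mul`, `pairOf_rational`, `continuous_pairOf`,
`pairOf_of_scalar`, `isNormOne_pairOf`), t4-L1-p5's `NormOneTorus` (`qmul`, `qnorm`, `qrat`: the norm-one torus
`E′¹(𝔸) = {z ∈ 𝔸_k[√−d] : N z = 1}` on pairs), t4-L1-p3's `LinRegular` (`exists_regular_rational`), t4-L1-p4's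
`RTFDataOfCharacters` (`RTFData.ofCharacters` with its seven displayed character clauses).

WHAT IS DEFINED.
* `IsU1Char d ν` — «`ν` is a continuous unitary character of `E′¹(𝔸)` trivial on `E′¹(k)`», DEFINED on Mathlib's
  adeles through p5's pair model of `𝔸_k[√−d]`: multiplicative for `qmul` on the norm-one locus, `ν (qrat k x) = 1` for
  rational norm-one `x`, continuous on the norm-one locus, of modulus one there.  Nothing is claimed about the
  EXISTENCE of such characters beyond the trivial one: the four corner characters `ν₀ … ν₃` of the line are its
  FREE input (the printed identification `f^*Ω_s = θ(μ₀) ∧ θ(μ₁)` ties them to the corners).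
* `prodChar D ν₀ ν₁ P` — the character `ν₀ ⊗ ν₁` of the torus `commutant (P 0) ⊓ commutant (P 1)` through its two
  `U(1)` factors: `t ↦ ν₀ (x, y) · ν₁ (x′, y′)` for `pairOf D t = (x, y, x′, y′)`; `torusT W` and `torusT' W` are
  these tori for `P := W.P` and `P := W.Q` (by `rfl`).

WHAT IS PROVED (Mathlib + the named modules only, no printed input), for a genuine definite plane and `D` the torus
data of the projector pair (p5's `planeTorusData`; `hDB hDOm hDP` as in TorusCocompact, `hDd : D.d = d`):
`prodChar_mul` (multiplicative), `prodChar_rational` (trivial on the rational points), `continuous_prodChar`,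
`norm_prodChar` (unitary); `centre_scalar` — the centre `Z = T ⊓ T′ ⊓ Z(U(W)(𝔸_k))` consists of `E′_𝔸`-scalars (from
p3's `exists_regular_rational`: a central element of both tori commutes with the linearly regular rational `γ₀`);
hence `prodChar_centre`: N2 (`χ = χ′` on the centre) follows from the DISPLAYED equation `ν₀ ν₁ = ν₂ ν₃` on `E′¹(𝔸)`.
`RTFData.ofU1Characters` packages the seven clauses of p4's `RTFData.ofCharacters`, and
`exists_rtfData_of_u1Characters` is the bundled existence with the continuity / unitarity / Haar / compactness facts
that the skeleton's `Inputs` block (`R, hc, hu, hc', hu'`, Skeleton v0.34) consumes.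

Nothing here says anything about the status of the Hodge conjecture for CM abelian varieties, which is NOT proved
(HC_CM is NOT proved by anyone in this repository).
-/

set_option autoImplicit false

noncomputable section

namespace Summit.Ventures.HodgeRepro.Tier4.Line1

open NumberField MeasureTheory Summit.Ventures.HodgeRepro.Tier4.Common Matrix Rot

variable {k : Type} [Field k] [NumberField k] {W : PlaneData k}

/-! ## 2. `U(1)`-characters on the norm-one torus and the product characters of the tori -/

section Characters

/-- **a continuous unitary character of `E′¹(𝔸) = {z ∈ 𝔸_k[√−d] : N z = 1}` trivial on `E′¹(k)`**, in p5's pair model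
of `𝔸_k[√−d]` (`qmul`, `qnorm`, `qrat`): multiplicative on the norm-one locus, trivial on the rational norm-one
elements, continuous on the norm-one locus, of modulus one there.  Values off the norm-one locus are junk. -/
structure IsU1Char (d : k) (ν : (Fin 2 → Ad k) → ℂ) : Prop where
  /-- multiplicative on `E′¹(𝔸)` -/
  mul : ∀ z w : Fin 2 → Ad k, qnorm (algebraMap k (Ad k) d) z = 1 → qnorm (algebraMap k (Ad k) d) w = 1 →
    ν (qmul (algebraMap k (Ad k) d) z w) = ν z * ν w
  /-- trivial on `E′¹(k)` -/
  rational : ∀ x : Fin 2 → k, qnorm d x = 1 → ν (qrat k x) = 1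
  /-- continuous on `E′¹(𝔸)` -/
  continuousOn : ContinuousOn ν {z | qnorm (algebraMap k (Ad k) d) z = 1}
  /-- unitary on `E′¹(𝔸)` -/
  unitary : ∀ z : Fin 2 → Ad k, qnorm (algebraMap k (Ad k) d) z = 1 → ‖ν z‖ = 1

/-- the first half `(x, y)` of a pair `(x, y, x′, y′)` -/
def pfst {R : Type} (ρ : Fin 4 → R) : Fin 2 → R := ![ρ 0, ρ 1]

/-- the second half `(x′, y′)` of a pair `(x, y, x′, y′)` -/
def psnd {R : Type} (ρ : Fin 4 → R) : Fin 2 → R := ![ρ 2, ρ 3]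

/-- the halves of a norm-one pair have norm one -/
theorem qnorm_pfst_psnd {R : Type} [CommRing R] {d : R} {ρ : Fin 4 → R} (hρ : TorusData.IsNormOne d ρ) :
    qnorm d (pfst ρ) = 1 ∧ qnorm d (psnd ρ) = 1 := by
  obtain ⟨h1, h2⟩ := hρ
  simp only [qnorm, pfst, psnd, Matrix.cons_val_zero, Matrix.cons_val_one]
  exact ⟨h1, h2⟩

/-- the halves of a componentwise product are the `qmul`-products of the halves -/
theorem pfst_pmul_psnd_pmul {R : Type} [CommRing R] (d : R) (ρ ρ' : Fin 4 → R) :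
    pfst (TorusData.pmul d ρ ρ') = qmul d (pfst ρ) (pfst ρ') ∧
      psnd (TorusData.pmul d ρ ρ') = qmul d (psnd ρ) (psnd ρ') := by
  refine ⟨?_, ?_⟩ <;> funext i <;> fin_cases i <;> simp [pfst, psnd, TorusData.pmul, qmul]

/-- the halves of a rational pair read in `𝔸_k` are the rational halves read in `𝔸_k` -/
theorem pfst_psnd_rational (ρ₀ : Fin 4 → k) :
    pfst (fun i => algebraMap k (Ad k) (ρ₀ i)) = qrat k (pfst ρ₀) ∧
      psnd (fun i => algebraMap k (Ad k) (ρ₀ i)) = qrat k (psnd ρ₀) := by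
  refine ⟨?_, ?_⟩ <;> funext i <;> fin_cases i <;> simp [pfst, psnd, qrat]

/-- the halves are continuous -/
theorem continuous_pfst_psnd {R : Type} [TopologicalSpace R] :
    Continuous (pfst : (Fin 4 → R) → Fin 2 → R) ∧ Continuous (psnd : (Fin 4 → R) → Fin 2 → R) := by
  refine ⟨continuous_pi fun i => ?_, continuous_pi fun i => ?_⟩ <;> fin_cases i <;>
    simp only [pfst, psnd, Matrix.cons_val_zero, Matrix.cons_val_one, Fin.zero_eta,
      Fin.isValue, Fin.mk_one] <;> exact continuous_apply _

variable {P : Fin 2 → Matrix (Fin 4) (Fin 4) k}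

/-- **the character `ν₀ ⊗ ν₁` of the torus `commutant (P 0) ⊓ commutant (P 1)`** through its two `U(1)` factors:
`t ↦ ν₀ (x, y) · ν₁ (x′, y′)` for `pairOf D t = (x, y, x′, y′)` (`torusT W` is this torus for `P := W.P`, `torusT' W`
for `P := W.Q`). -/
def prodChar (D : TorusData k) (ν₀ ν₁ : (Fin 2 → Ad k) → ℂ) (P : Fin 2 → Matrix (Fin 4) (Fin 4) k) :
    (commutant W (P 0) ⊓ commutant W (P 1) : Subgroup (GA W)) → ℂ :=
  fun t => ν₀ (pfst (pairOf D (t : GA W))) * ν₁ (psnd (pairOf D (t : GA W)))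

variable (D : TorusData k) (hDB : D.B = W.B) (hDOm : D.Om = W.Ωᵀ) (hDP : D.P = (P 0)ᵀ) {d : k} (hDd : D.d = d)
  {ν₀ ν₁ : (Fin 2 → Ad k) → ℂ} (h₀ : IsU1Char d ν₀) (h₁ : IsU1Char d ν₁)

include hDB hDOm hDP hDd h₀ h₁ in
/-- **`ν₀ ⊗ ν₁` is multiplicative** (`pairOf_mul` + the multiplicativity of the two characters) -/
theorem prodChar_mul (s t : (commutant W (P 0) ⊓ commutant W (P 1) : Subgroup (GA W))) :
    prodChar D ν₀ ν₁ P (s * t) = prodChar D ν₀ ν₁ P s * prodChar D ν₀ ν₁ P t := by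
  have hs := qnorm_pfst_psnd (isNormOne_pairOf D hDB hDOm hDP (s : GA W) s.2.1)
  have ht := qnorm_pfst_psnd (isNormOne_pairOf D hDB hDOm hDP (t : GA W) t.2.1)
  rw [hDd] at hs ht
  simp only [prodChar, Subgroup.coe_mul, pairOf_mul D hDB hDOm hDP (s : GA W) (t : GA W) s.2.1 t.2.1,
    (pfst_pmul_psnd_pmul _ _ _).1, (pfst_pmul_psnd_pmul _ _ _).2, hDd,
    h₀.mul _ _ hs.1 ht.1, h₁.mul _ _ hs.2 ht.2]
  ring

include hDB hDOm hDP hDd h₀ h₁ in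
/-- **`ν₀ ⊗ ν₁` is trivial on the rational points of the torus** (`pairOf_rational` + the triviality of the two
characters on `E′¹(k)`) -/
theorem prodChar_rational (t : (commutant W (P 0) ⊓ commutant W (P 1) : Subgroup (GA W)))
    (ht : (t : GA W) ∈ rationalPoints W) : prodChar D ν₀ ν₁ P t = 1 := by
  obtain ⟨ρ₀, hρ₀, hp⟩ := pairOf_rational D hDB hDOm hDP (t : GA W) t.2.1 ht
  have hn := qnorm_pfst_psnd hρ₀
  rw [hDd] at hn
  simp only [prodChar, hp, (pfst_psnd_rational ρ₀).1, (pfst_psnd_rational ρ₀).2, h₀.rational _ hn.1,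
    h₁.rational _ hn.2, mul_one]

include hDB hDOm hDP hDd h₀ h₁ in
/-- **`ν₀ ⊗ ν₁` is continuous** (`pairOf` is continuous into the norm-one locus, where the characters are) -/
theorem continuous_prodChar : Continuous (prodChar (W := W) D ν₀ ν₁ P) := by
  have hpair : Continuous fun t : (commutant W (P 0) ⊓ commutant W (P 1) : Subgroup (GA W)) =>
      pairOf D (t : GA W) := (continuous_pairOf D).comp continuous_subtype_val
  have hmem : ∀ t : (commutant W (P 0) ⊓ commutant W (P 1) : Subgroup (GA W)),
      qnorm (algebraMap k (Ad k) d) (pfst (pairOf D (t : GA W))) = 1 ∧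
        qnorm (algebraMap k (Ad k) d) (psnd (pairOf D (t : GA W))) = 1 := fun t => by
    have := qnorm_pfst_psnd (isNormOne_pairOf D hDB hDOm hDP (t : GA W) t.2.1)
    rwa [hDd] at this
  refine Continuous.mul ?_ ?_
  · exact h₀.continuousOn.comp_continuous ((continuous_pfst_psnd).1.comp hpair) fun t => (hmem t).1
  · exact h₁.continuousOn.comp_continuous ((continuous_pfst_psnd).2.comp hpair) fun t => (hmem t).2

include hDB hDOm hDP hDd h₀ h₁ in
/-- **`ν₀ ⊗ ν₁` is unitary** -/
theorem norm_prodChar (t : (commutant W (P 0) ⊓ commutant W (P 1) : Subgroup (GA W))) :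
    ‖prodChar D ν₀ ν₁ P t‖ = 1 := by
  have hn := qnorm_pfst_psnd (isNormOne_pairOf D hDB hDOm hDP (t : GA W) t.2.1)
  rw [hDd] at hn
  simp only [prodChar, norm_mul, h₀.unitary _ hn.1, h₁.unitary _ hn.2, mul_one]

end Characters

/-! ## 3. The centre is scalar; N2 from the displayed equation `ν₀ ν₁ = ν₂ ν₃` on `E′¹(𝔸)` -/

section Centre

/-- **the centre `Z = T ⊓ T′ ⊓ Z(U(W)(𝔸_k))` of a genuine definite plane consists of `E′_𝔸`-scalars**: a central element
of both tori commutes with p3's linearly regular rational `γ₀` (`exists_regular_rational`), and `IsLinRegular` makes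
it `x·1 + y·Ω`. -/
theorem centre_scalar (hW : IsDefinite W) (hg : IsGenuineRow W) (z : GA W) (hz : z ∈ centre W) :
    ∃ x y : Ad k, GA.mat W z = x • (1 : M4 k) + y • adMat k W.Ω := by
  obtain ⟨γ₀, hγ₀⟩ := exists_regular_rational W hW hg
  have hΩ : GA.mat W z * adMat k W.Ω = adMat k W.Ω * GA.mat W z := ((mem_unitaryGroup W _).mp z.2).1
  have hP : ∀ i, GA.mat W z * adMat k (W.P i) = adMat k (W.P i) * GA.mat W z := by
    intro i
    fin_cases i
    · exact hz.1.1.1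
    · exact hz.1.1.2
  have hQ : ∀ i, GA.mat W z * adMat k (W.Q i) = adMat k (W.Q i) * GA.mat W z := by
    intro i
    fin_cases i
    · exact hz.1.2.1
    · exact hz.1.2.2
  have hcomm : GA.mat W z * GA.mat W (γ₀ : GA W) = GA.mat W (γ₀ : GA W) * GA.mat W z := by
    have h := (Subgroup.mem_center_iff.mp hz.2) (γ₀ : GA W)
    rw [← GA.mat_mul, ← GA.mat_mul, h]
  obtain ⟨x, y, hxy, -⟩ := hγ₀ (GA.mat W z) (GA.mat W z) hΩ hP hΩ hQ hcomm
  exact ⟨x, y, hxy⟩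

variable (D D' : TorusData k) (hDB : D.B = W.B) (hDOm : D.Om = W.Ωᵀ) (hDP : D.P = (W.P 0)ᵀ)
  (hD'B : D'.B = W.B) (hD'Om : D'.Om = W.Ωᵀ) (hD'P : D'.P = (W.Q 0)ᵀ) {d : k} (hDd : D.d = d) (hD'd : D'.d = d)
  {ν₀ ν₁ ν₂ ν₃ : (Fin 2 → Ad k) → ℂ}

include hDB hDOm hDP hD'Om hDd in
/-- **N2 from the displayed equation `ν₀ ν₁ = ν₂ ν₃` on `E′¹(𝔸)`**: on a central element `z = a·1 + b·Ω` both
pairs are `(a, b, a, b)`, so `χ(z) = ν₀(a,b) ν₁(a,b)` and `χ′(z) = ν₂(a,b) ν₃(a,b)`. -/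
theorem prodChar_centre (hW : IsDefinite W) (hg : IsGenuineRow W)
    (hN2 : ∀ s : Fin 2 → Ad k, qnorm (algebraMap k (Ad k) d) s = 1 → ν₀ s * ν₁ s = ν₂ s * ν₃ s)
    (z : GA W) (hz : z ∈ centre W) :
    prodChar D ν₀ ν₁ W.P ⟨z, centre_le_torusT W hz⟩ = prodChar D' ν₂ ν₃ W.Q ⟨z, centre_le_torusT' W hz⟩ := by
  obtain ⟨a, b, hab⟩ := centre_scalar hW hg z hz
  have hp : pairOf D z = ![a, b, a, b] := pairOf_of_scalar D hDOm z hab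
  have hp' : pairOf D' z = ![a, b, a, b] := pairOf_of_scalar D' hD'Om z hab
  have hn := (qnorm_pfst_psnd (isNormOne_pairOf D hDB hDOm hDP z hz.1.1.1)).1
  rw [hDd, hp] at hn
  have hfst : pfst (![a, b, a, b] : Fin 4 → Ad k) = ![a, b] := by
    funext i; fin_cases i <;> simp [pfst]
  have hsnd : psnd (![a, b, a, b] : Fin 4 → Ad k) = ![a, b] := by
    funext i; fin_cases i <;> simp [psnd]
  rw [hfst] at hn
  simp only [prodChar, hp, hp', hfst, hsnd]
  exact hN2 _ hn

end Centre

/-! ## 4. The RTF datum from four `U(1)`-characters and N2 (p4's `RTFData.ofCharacters` with the clauses proved) -/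

section Datum

variable [MeasurableSpace (GA W)] [BorelSpace (GA W)] (hW : IsDefinite W) (hg : IsGenuineRow W)
  (D D' : TorusData k) (hDB : D.B = W.B) (hDOm : D.Om = W.Ωᵀ) (hDP : D.P = (W.P 0)ᵀ)
  (hD'B : D'.B = W.B) (hD'Om : D'.Om = W.Ωᵀ) (hD'P : D'.P = (W.Q 0)ᵀ) {d : k} (hDd : D.d = d) (hD'd : D'.d = d)
  (ν₀ ν₁ ν₂ ν₃ : (Fin 2 → Ad k) → ℂ) (h₀ : IsU1Char d ν₀) (h₁ : IsU1Char d ν₁) (h₂ : IsU1Char d ν₂)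
  (h₃ : IsU1Char d ν₃)
  (hN2 : ∀ s : Fin 2 → Ad k, qnorm (algebraMap k (Ad k) d) s = 1 → ν₀ s * ν₁ s = ν₂ s * ν₃ s)

/-- **the RTF datum of four `U(1)`-characters** `χ = ν₀ ⊗ ν₁` on `T`, `χ′ = ν₂ ⊗ ν₃` on `T′`, with N2 from the
displayed equation `ν₀ ν₁ = ν₂ ν₃` on `E′¹(𝔸)`: p4's `RTFData.ofCharacters` with its seven clauses PROVED. -/
def RTFData.ofU1Characters : RTFData W :=
  RTFData.ofCharacters W hW hg (prodChar D ν₀ ν₁ W.P) (prodChar D' ν₂ ν₃ W.Q)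
    (prodChar_mul D hDB hDOm hDP hDd h₀ h₁) (prodChar_mul D' hD'B hD'Om hD'P hD'd h₂ h₃)
    (prodChar_rational D hDB hDOm hDP hDd h₀ h₁) (prodChar_rational D' hD'B hD'Om hD'P hD'd h₂ h₃)
    (prodChar_centre D D' hDB hDOm hDP hD'Om hDd hW hg hN2)

/-- the character `χ` of the datum is `ν₀ ⊗ ν₁` -/
theorem ofU1Characters_chi :
    (RTFData.ofU1Characters hW hg D D' hDB hDOm hDP hD'B hD'Om hD'P hDd hD'd ν₀ ν₁ ν₂ ν₃ h₀ h₁ h₂ h₃ hN2).chi =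
      prodChar D ν₀ ν₁ W.P := rfl

/-- the character `χ′` of the datum is `ν₂ ⊗ ν₃` -/
theorem ofU1Characters_chi' :
    (RTFData.ofU1Characters hW hg D D' hDB hDOm hDP hD'B hD'Om hD'P hDd hD'd ν₀ ν₁ ν₂ ν₃ h₀ h₁ h₂ h₃ hN2).chi' =
      prodChar D' ν₂ ν₃ W.Q := rfl

include hW hg hDB hDOm hDP hD'B hD'Om hD'P hDd hD'd h₀ h₁ h₂ h₃ hN2 in
/-- **Bundled form, the `Inputs` block of the skeleton**: an `RTFData` with the characters `ν₀ ⊗ ν₁`, `ν₂ ⊗ ν₃`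
(continuous and unitary), Haar torus measures and relatively compact torus domains exists, from four
`U(1)`-characters and the displayed N2 equation. -/
theorem exists_rtfData_of_u1Characters :
    ∃ R : RTFData W, R.chi = prodChar D ν₀ ν₁ W.P ∧ R.chi' = prodChar D' ν₂ ν₃ W.Q ∧
      Continuous R.chi ∧ (∀ a, ‖R.chi a‖ = 1) ∧ Continuous R.chi' ∧ (∀ a, ‖R.chi' a‖ = 1) ∧
      R.μT.IsHaarMeasure ∧ R.μT'.IsHaarMeasure ∧ IsCompact (closure R.DT) ∧ IsCompact (closure R.DT') := by
  obtain ⟨R, hchi, hchi', hμ, hμ', hT, hT'⟩ := exists_rtfData_of_characters W hW hg (prodChar D ν₀ ν₁ W.P)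
    (prodChar D' ν₂ ν₃ W.Q) (prodChar_mul D hDB hDOm hDP hDd h₀ h₁) (prodChar_mul D' hD'B hD'Om hD'P hD'd h₂ h₃)
    (prodChar_rational D hDB hDOm hDP hDd h₀ h₁) (prodChar_rational D' hD'B hD'Om hD'P hD'd h₂ h₃)
    (prodChar_centre D D' hDB hDOm hDP hD'Om hDd hW hg hN2)
  refine ⟨R, hchi, hchi', ?_, ?_, ?_, ?_, hμ, hμ', hT, hT'⟩
  · rw [hchi]; exact continuous_prodChar D hDB hDOm hDP hDd h₀ h₁
  · rw [hchi]; exact norm_prodChar D hDB hDOm hDP hDd h₀ h₁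
  · rw [hchi']; exact continuous_prodChar D' hD'B hD'Om hD'P hD'd h₂ h₃
  · rw [hchi']; exact norm_prodChar D' hD'B hD'Om hD'P hD'd h₂ h₃

end Datum

end Summit.Ventures.HodgeRepro.Tier4.Line1

end
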